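import Literature.Geometry.Riemannian.TwistorFrameChange
import Literature.Geometry.Riemannian.RiemannianDistance
import Literature.Geometry.Kaehler.OrthonormalFrame
import Literature.Geometry.Lorentzian.CurvatureSymmetries
import HarnessLib

/-!
# Smooth positive orthonormal frame fields on an oriented Riemannian 4-manifold
(topic `Geometry/Riemannian`; support for `exists_twistorSpace`, `TwistorPackage.lean`)

The index set of the atlas of the twistor space: for a Riemannian metric `g`
(`PseudoRiemannianMetric (𝓡 4) ∞ …`, `g.IsRiemannian`) and a smooth orientation `o` on a smooth
4-manifold `M`, a `TwistorFrame g o` is an open set `U` with a frame field `e = (e₀, …, e₃)`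
which is smooth on `U` (as sections of `TM`), `g`-orthonormal and positively `o`-oriented at every
point of `U` — exactly the data entering `IsTwistorSpaceOf`. We prove

* `exists_twistorFrame` — every point lies in the open set of some twistor frame (Warner 1983,
  4.10: Gram–Schmidt on the coordinate frame of a chart, `Literature.Geometry.Kaehler.orthoFrame`,
  through the bridge `g.riemannianBundle`; the orientation is fixed by reversing `e₃` if necessary,
  and positivity propagates to a neighbourhood because the orientation character is locally
  constant along a continuously moving frame, `SmoothOrientation.eventually_isPosFrame_iff`);
* `contMDiffOn_frameTransition_apply` — for two twistor frames the transition map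
  `x ↦ frameTransition g x (e x) (e' x) ζ` of the twistor fibre (`TwistorFrameChange.lean`) is
  smooth on `U ∩ U'` (it is a polynomial in the pairings `g(e'_p, e_c)` of smooth sections), and
  jointly smooth in `(x, ζ)` on `(U ∩ U') × S²`;
* the pointwise consequences on `U ∩ U'` of `frameComplexStructure_frameChange`
  (`TwistorFrame.frameComplexStructure_eq`, `norm_frameTransition`, cocycle).

Everything here is proved; no named facts are introduced.

## References

* F. W. Warner, *Foundations of Differentiable Manifolds and Lie Groups*, GTM 94 (1983), 4.10.
  [WarnerGTM94]
* M. F. Atiyah, N. J. Hitchin, I. M. Singer, *Self-duality in four-dimensional Riemannian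
  geometry*, Proc. R. Soc. A 362 (1978), §1, §4. [AtiyahHitchinSinger1978]
-/

noncomputable section

open scoped Manifold ContDiff Matrix BigOperators Topology
open Bundle Set Filter Module Function

namespace Literature.Geometry.Riemannian

open Literature.Geometry.Lorentzian (PseudoRiemannianMetric)
open Literature.Geometry.Lorentzian.PseudoRiemannianMetric
open Literature.Topology.FourManifolds (SmoothOrientation)
open Literature.Topology.FourManifolds

/-- Local notation: the model space `ℝ⁴`. -/
local notation "E4" => EuclideanSpace ℝ (Fin 4)

variable {M : Type*} [TopologicalSpace M] [ChartedSpace (EuclideanSpace ℝ (Fin 4)) M]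
  [IsManifold (𝓡 4) ∞ M]
  {g : PseudoRiemannianMetric (𝓡 4) ∞ E4 (TangentSpace (𝓡 4) : M → Type _)}

/-! ### Twistor frames -/

variable (g) in
/-- **A twistor frame** of the oriented Riemannian 4-manifold `(M, o, g)`: an open set `U` and a
frame field `e` on `M` which on `U` is smooth (as sections of `TM`), `g`-orthonormal and
positively `o`-oriented — the data of a local trivialisation `S(Λ⁺)|_U ≅ U × S²` of the twistor
space (`IsTwistorSpaceOf`). [cite: AtiyahHitchinSinger1978, §4] -/
structure TwistorFrame (o : SmoothOrientation (𝓡 4) M) where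
  /-- The open set carrying the frame. -/
  U : TopologicalSpace.Opens M
  /-- The frame field (meaningful on `U`). -/
  frame : Fin 4 → Π x : M, TangentSpace (𝓡 4) x
  /-- The frame is smooth on `U`. -/
  contMDiffOn_frame : ∀ a, ContMDiffOn (𝓡 4) (𝓡 4).tangent ∞
    (fun x ↦ (TotalSpace.mk' E4 x (frame a x) : TangentBundle (𝓡 4) M)) (U : Set M)
  /-- The frame is `g`-orthonormal on `U`. -/
  isOrthonormalFrame : ∀ x ∈ U, g.IsOrthonormalFrame x (fun a ↦ frame a x)
  /-- The frame is positively oriented on `U`. -/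
  isPosFrame : ∀ x ∈ U, o.IsPosFrame x (fun i ↦ frame (Fin.cast finrank_euclideanSpace_fin i) x)

namespace TwistorFrame

variable {o : SmoothOrientation (𝓡 4) M} (F F' F'' : TwistorFrame g o)

/-- The frame of a twistor frame at a point. [folklore] -/
abbrev fr (x : M) : Fin 4 → TangentSpace (𝓡 4) x := fun a ↦ F.frame a x

/-- The frame is smooth at every point of `U`. [folklore] -/
theorem contMDiffAt_frame {x : M} (hx : x ∈ F.U) (a : Fin 4) :
    ContMDiffAt (𝓡 4) (𝓡 4).tangent ∞
      (fun x ↦ (TotalSpace.mk' E4 x (F.frame a x) : TangentBundle (𝓡 4) M)) x :=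
  (F.contMDiffOn_frame a x hx).contMDiffAt (F.U.isOpen.mem_nhds hx)

/-- **The transition map between two twistor frames intertwines the fibres**:
`J_ζ(e'(x)) = J_{T(x) ζ}(e(x))` on `U ∩ U'`, `T(x) = frameTransition g x (e x) (e' x)`
(`frameComplexStructure_frameChange` with the orientation character of `o` as the alternating
form). [cite: AtiyahHitchinSinger1978, §1] -/
theorem frameComplexStructure_eq {x : M} (hx : x ∈ F.U) (hx' : x ∈ F'.U) (ζ : Fin 3 → ℝ) :
    frameComplexStructure g x (F'.fr x) ζ =
      frameComplexStructure g x (F.fr x) (frameTransition g x (F.fr x) (F'.fr x) ζ) := by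
  obtain ⟨vol, hvol⟩ := exists_alternating_pos_of_isPosFrame o x
  exact frameComplexStructure_frameChange (F.isOrthonormalFrame x hx) (F'.isOrthonormalFrame x hx')
    finrank_euclideanSpace_fin vol (hvol _ _ (F.isPosFrame x hx) (F'.isPosFrame x hx')) ζ

/-- The transition map preserves `|ζ|²`. [cite: AtiyahHitchinSinger1978, §1] -/
theorem frameTransition_dotProduct_self {x : M} (hx : x ∈ F.U) (hx' : x ∈ F'.U) (ζ : Fin 3 → ℝ) :
    frameTransition g x (F.fr x) (F'.fr x) ζ ⬝ᵥ frameTransition g x (F.fr x) (F'.fr x) ζ =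
      ζ ⬝ᵥ ζ := by
  obtain ⟨vol, hvol⟩ := exists_alternating_pos_of_isPosFrame o x
  exact Riemannian.frameTransition_dotProduct_self (F.isOrthonormalFrame x hx)
    (F'.isOrthonormalFrame x hx') finrank_euclideanSpace_fin vol
    (hvol _ _ (F.isPosFrame x hx) (F'.isPosFrame x hx')) ζ

/-- The transition map preserves the dot and the cross product. [cite: AtiyahHitchinSinger1978, §1] -/
theorem frameTransition_dotProduct_crossProduct {x : M} (hx : x ∈ F.U) (hx' : x ∈ F'.U)
    (ζ η : Fin 3 → ℝ) :
    frameTransition g x (F.fr x) (F'.fr x) ζ ⬝ᵥ frameTransition g x (F.fr x) (F'.fr x) η = ζ ⬝ᵥ η ∧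
      frameTransition g x (F.fr x) (F'.fr x) (crossProduct ζ η) =
        crossProduct (frameTransition g x (F.fr x) (F'.fr x) ζ)
          (frameTransition g x (F.fr x) (F'.fr x) η) := by
  obtain ⟨vol, hvol⟩ := exists_alternating_pos_of_isPosFrame o x
  exact Riemannian.frameTransition_dotProduct_crossProduct (F.isOrthonormalFrame x hx)
    (F'.isOrthonormalFrame x hx') finrank_euclideanSpace_fin vol
    (hvol _ _ (F.isPosFrame x hx) (F'.isPosFrame x hx')) ζ η

/-- The transition map of a frame with itself is the identity. [folklore] -/
theorem frameTransition_self {x : M} (hx : x ∈ F.U) (ζ : Fin 3 → ℝ) :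
    frameTransition g x (F.fr x) (F.fr x) ζ = ζ :=
  Riemannian.frameTransition_self (F.isOrthonormalFrame x hx) ζ

/-- **Cocycle identity** for the transition maps of three twistor frames. [cite: AtiyahHitchinSinger1978, §1] -/
theorem frameTransition_frameTransition {x : M} (hx : x ∈ F.U) (hx' : x ∈ F'.U) (hx'' : x ∈ F''.U)
    (ζ : Fin 3 → ℝ) :
    frameTransition g x (F.fr x) (F'.fr x) (frameTransition g x (F'.fr x) (F''.fr x) ζ) =
      frameTransition g x (F.fr x) (F''.fr x) ζ := by
  obtain ⟨vol, hvol⟩ := exists_alternating_pos_of_isPosFrame o x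
  exact Riemannian.frameTransition_frameTransition (F.isOrthonormalFrame x hx)
    (F'.isOrthonormalFrame x hx') (F''.isOrthonormalFrame x hx'') finrank_euclideanSpace_fin vol
    (hvol _ _ (F.isPosFrame x hx) (F'.isPosFrame x hx'))
    (hvol _ _ (F'.isPosFrame x hx') (F''.isPosFrame x hx'')) ζ

/-- The transition map on the unit sphere is norm preserving (Euclidean norm of `ℝ³`). [folklore] -/
theorem norm_frameTransition {x : M} (hx : x ∈ F.U) (hx' : x ∈ F'.U)
    (ζ : EuclideanSpace ℝ (Fin 3)) :
    ‖WithLp.toLp 2 (frameTransition g x (F.fr x) (F'.fr x) (WithLp.ofLp ζ))‖ = ‖ζ‖ := by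
  rw [EuclideanSpace.norm_eq, EuclideanSpace.norm_eq]
  congr 1
  have h := F.frameTransition_dotProduct_self F' hx hx' (WithLp.ofLp ζ)
  simp only [dotProduct, ← sq] at h
  simp only [Real.norm_eq_abs, sq_abs]
  exact h

end TwistorFrame

/-! ### Smoothness of the transition maps -/

namespace TwistorFrame

variable {o : SmoothOrientation (𝓡 4) M} (F F' : TwistorFrame g o)

/-- The pairings `x ↦ g(e'_p(x), e_c(x))` of two twistor frames are smooth on `U ∩ U'`. [folklore] -/
theorem contMDiffOn_val_frame (p c : Fin 4) :
    ContMDiffOn (𝓡 4) 𝓘(ℝ, ℝ) ∞ (fun x ↦ g.val x (F'.frame p x) (F.frame c x))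
      ((F.U : Set M) ∩ F'.U) := fun _ hx ↦
  (g.contMDiffAt_val_apply le_rfl (F'.contMDiffAt_frame hx.2 p)
    (F.contMDiffAt_frame hx.1 c)).contMDiffWithinAt

/-- Explicit form of the transition map: a polynomial in the pairings of the two frames.
[folklore] -/
theorem frameTransition_apply_eq (x : M) (ζ : Fin 3 → ℝ) (m : Fin 3) :
    frameTransition g x (F.fr x) (F'.fr x) ζ m =
      ∑ i, ζ i * ∑ k,
        (g.val x (F'.frame (selfDualIdx i k).1 x) (F.frame 0 x) *
            g.val x (F'.frame (selfDualIdx i k).2 x) (F.frame m.succ x) -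
          g.val x (F'.frame (selfDualIdx i k).2 x) (F.frame 0 x) *
            g.val x (F'.frame (selfDualIdx i k).1 x) (F.frame m.succ x)) := by
  simp only [frameTransition_apply, frameComplexStructure, FunLike.coe_sum, FunLike.coe_smul,
    Finset.sum_apply, Pi.smul_apply, selfDualPairs_eq, bivectorEnd_apply, map_sum, map_smul,
    map_sub, FunLike.coe_sub, Pi.sub_apply, smul_eq_mul]

/-- **The transition map is smooth on `U ∩ U'`** (each component, for fixed `ζ`). [folklore] -/
theorem contMDiffOn_frameTransition_apply (ζ : Fin 3 → ℝ) (m : Fin 3) :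
    ContMDiffOn (𝓡 4) 𝓘(ℝ, ℝ) ∞ (fun x ↦ frameTransition g x (F.fr x) (F'.fr x) ζ m)
      ((F.U : Set M) ∩ F'.U) := by
  have h : (fun x ↦ frameTransition g x (F.fr x) (F'.fr x) ζ m) = fun x ↦
      ∑ i, ζ i * ∑ k,
        (g.val x (F'.frame (selfDualIdx i k).1 x) (F.frame 0 x) *
            g.val x (F'.frame (selfDualIdx i k).2 x) (F.frame m.succ x) -
          g.val x (F'.frame (selfDualIdx i k).2 x) (F.frame 0 x) *
            g.val x (F'.frame (selfDualIdx i k).1 x) (F.frame m.succ x)) :=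
    funext fun x ↦ F.frameTransition_apply_eq F' x ζ m
  rw [h]
  refine contMDiffOn_finsetSum fun i _ ↦ contMDiffOn_const.mul (contMDiffOn_finsetSum fun k _ ↦ ?_)
  exact ((F.contMDiffOn_val_frame F' _ _).mul (F.contMDiffOn_val_frame F' _ _)).sub
    ((F.contMDiffOn_val_frame F' _ _).mul (F.contMDiffOn_val_frame F' _ _))

end TwistorFrame

/-! ### Existence of twistor frames around every point -/

section Existence

variable (g) in
/-- Orthonormality for the inner products of `g.riemannianBundle hg` is `g`-orthonormality (copy of
`isOrthonormalFrame_of_orthonormal` of `NeumannIsotropicFormPos.lean`, not imported here).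
[folklore] -/
private theorem isOrthonormalFrame_of_orthonormal_aux (hg : g.IsRiemannian)
    {x : M} {ι : Type*} {e : ι → TangentSpace (𝓡 4) x}
    (he : letI := g.riemannianBundle hg; Orthonormal ℝ e) : g.IsOrthonormalFrame x e := by
  classical
  letI := g.riemannianBundle hg
  rw [orthonormal_iff_ite] at he
  refine ⟨fun i ↦ ?_, fun i j hij ↦ ?_⟩
  · have h := he i i
    rw [if_pos rfl] at h
    exact h
  · have h := he i j
    rw [if_neg hij] at h
    exact h

/-- Reading a section in the trivialisation of `TM` at `x₀` is applying the derivative of the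
chart change `tangentCoordChange`. [folklore] -/
theorem trivializationAt_snd_eq_tangentCoordChange (x₀ y : M) (v : TangentSpace (𝓡 4) y) :
    ((trivializationAt E4 (TangentSpace (𝓡 4)) x₀) ⟨y, v⟩).2 = tangentCoordChange (𝓡 4) y x₀ y v :=
  rfl

/-- A smooth frame field read in the chart at `x₀` moves continuously: each
`y ↦ tangentCoordChange (𝓡 4) y x₀ y (e_a y)` is continuous at `x₀`. [folklore] -/
theorem continuousAt_tangentCoordChange_frame {e : Π x : M, TangentSpace (𝓡 4) x} {x₀ : M}
    (he : ContMDiffAt (𝓡 4) (𝓡 4).tangent ∞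
      (fun x ↦ (TotalSpace.mk' E4 x (e x) : TangentBundle (𝓡 4) M)) x₀) :
    ContinuousAt (fun y ↦ tangentCoordChange (𝓡 4) y x₀ y (e y)) x₀ := by
  have h := (contMDiffAt_section (F := E4) (E := (TangentSpace (𝓡 4) : M → Type _)) x₀).1 he
  exact h.continuousAt

omit [IsManifold (𝓡 4) ∞ M] in
/-- **Positivity of a smooth orthonormal frame field propagates from a point to a neighbourhood**:
the orientation character is locally constant along a continuously moving frame
(`SmoothOrientation.eventually_isPosFrame_iff` and continuity of the determinant). [folklore] -/
theorem eventually_isPosFrame_of_isPosFrame [IsManifold (𝓡 4) ∞ M] (o : SmoothOrientation (𝓡 4) M)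
    {e : Fin 4 → Π x : M, TangentSpace (𝓡 4) x} {x₀ : M}
    (he : ∀ a, ContMDiffAt (𝓡 4) (𝓡 4).tangent ∞
      (fun x ↦ (TotalSpace.mk' E4 x (e a x) : TangentBundle (𝓡 4) M)) x₀)
    (hpos : o.IsPosFrame x₀ (fun i ↦ e (Fin.cast finrank_euclideanSpace_fin i) x₀)) :
    ∀ᶠ y in 𝓝 x₀, o.IsPosFrame y (fun i ↦ e (Fin.cast finrank_euclideanSpace_fin i) y) := by
  set Fr : M → (Fin (finrank ℝ E4) → E4) :=
    fun y i ↦ tangentCoordChange (𝓡 4) y x₀ y (e (Fin.cast finrank_euclideanSpace_fin i) y) with hFr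
  have hc : ContinuousAt Fr x₀ :=
    continuousAt_pi.2 fun i ↦ continuousAt_tangentCoordChange_frame (he _)
  have hdet : ContinuousAt (fun y ↦ o.sign x₀ * (finBasis ℝ E4).det (Fr y)) x₀ :=
    continuousAt_const.mul ((continuous_basis_det (finBasis ℝ E4)).continuousAt.comp hc)
  have h0 : Fr x₀ = fun i ↦ e (Fin.cast finrank_euclideanSpace_fin i) x₀ := by
    funext i
    exact tangentCoordChange_self (mem_extChartAt_source x₀)
  have hpos' : 0 < o.sign x₀ * (finBasis ℝ E4).det (Fr x₀) := by
    rw [h0]; exact hpos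
  have hev : ∀ᶠ y in 𝓝 x₀, 0 < o.sign x₀ * (finBasis ℝ E4).det (Fr y) :=
    hdet.eventually (eventually_gt_nhds hpos')
  filter_upwards [o.eventually_isPosFrame_iff x₀, hev] with y hy hy'
  exact (hy _).2 hy'

omit [IsManifold (𝓡 4) ∞ M] in
/-- Negating one vector field of a frame, pointwise. [folklore] -/
private theorem update_neg_apply (s : Fin 4 → Π x : M, TangentSpace (𝓡 4) x) (x : M) :
    (fun a ↦ update s 3 (-s 3) a x) = update (fun a ↦ s a x) 3 (-s 3 x) := by
  funext a
  by_cases ha : a = 3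
  · subst ha; simp
  · simp [ha]

variable (g) in
/-- **Twistor frames exist around every point** of an oriented Riemannian 4-manifold: the
Gram–Schmidt orthonormalisation of the coordinate frame of the chart at `x₀`
(`Literature.Geometry.Kaehler.orthoFrame`, Warner 1983, 4.10) is a smooth `g`-orthonormal frame
field on the chart domain; reversing `e₃` if necessary makes it positive at `x₀`, hence on a
neighbourhood (`eventually_isPosFrame_of_isPosFrame`). [cite: WarnerGTM94, 4.10, p. 157] -/
theorem exists_twistorFrame (hg : g.IsRiemannian) (o : SmoothOrientation (𝓡 4) M) (x₀ : M) :
    ∃ F : TwistorFrame g o, x₀ ∈ F.U := by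
  classical
  letI := g.riemannianBundle hg
  haveI : Fact (finrank ℝ E4 = 4) := ⟨finrank_euclideanSpace_fin⟩
  set S : Set M := (chartAt E4 x₀).source with hS
  have hSo : IsOpen S := (chartAt E4 x₀).open_source
  have hx₀ : x₀ ∈ S := mem_chart_source E4 x₀
  set s : Fin 4 → Π x : M, TangentSpace (𝓡 4) x := Kaehler.orthoFrame (𝓡 4) 4 x₀ with hs
  have hsON : ∀ x ∈ S, g.IsOrthonormalFrame x (fun i ↦ s i x) := fun x hx ↦
    isOrthonormalFrame_of_orthonormal_aux g hg (Kaehler.orthonormal_orthoFrame (I := 𝓡 4) (n := 4) hx)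
  have hsC : ∀ a, ∀ x ∈ S, ContMDiffAt (𝓡 4) (𝓡 4).tangent ∞
      (fun y ↦ (TotalSpace.mk' E4 y (s a y) : TangentBundle (𝓡 4) M)) x :=
    fun a x hx ↦ Kaehler.contMDiffAt_orthoFrame hx a
  -- fix the orientation at `x₀`
  obtain ⟨e, heC, heON, hepos⟩ : ∃ e : Fin 4 → Π x : M, TangentSpace (𝓡 4) x,
      (∀ a, ∀ x ∈ S, ContMDiffAt (𝓡 4) (𝓡 4).tangent ∞
        (fun y ↦ (TotalSpace.mk' E4 y (e a y) : TangentBundle (𝓡 4) M)) x) ∧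
      (∀ x ∈ S, g.IsOrthonormalFrame x (fun i ↦ e i x)) ∧
      o.IsPosFrame x₀ (fun i ↦ e (Fin.cast finrank_euclideanSpace_fin i) x₀) := by
    by_cases ho : o.IsPosFrame x₀ (fun i ↦ s (Fin.cast finrank_euclideanSpace_fin i) x₀)
    · exact ⟨s, hsC, hsON, ho⟩
    · refine ⟨update s 3 (-s 3), fun a x hx ↦ ?_, fun x hx ↦ ?_, ?_⟩
      · by_cases ha : a = 3
        · subst ha
          simp only [update_self]
          exact (hsC 3 x hx).neg_section
        · simp only [update_of_ne ha]
          exact hsC a x hx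
      · rw [update_neg_apply]
        exact (hsON x hx).update_neg 3
      · set h4 := (finrank_euclideanSpace_fin : finrank ℝ E4 = 4) with hh4
        have hli : LinearIndependent ℝ (fun i ↦ s (Fin.cast h4 i) x₀) :=
          (frame_linearIndependent (hsON x₀ hx₀)).comp _ (Fin.cast_injective h4)
        have hdet : (finBasis ℝ E4).det (fun i ↦ s (Fin.cast h4 i) x₀) ≠ 0 :=
          det_ne_zero_of_linearIndependent _ hli
        have h3 : (3 : Fin 4) = Fin.cast h4 (Fin.cast h4.symm 3) := by ext; simp
        have key : (fun i ↦ update s 3 (-s 3) (Fin.cast h4 i) x₀) =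
            update (fun i ↦ s (Fin.cast h4 i) x₀) (Fin.cast h4.symm 3) (-s 3 x₀) := by
          calc (fun i ↦ update s 3 (-s 3) (Fin.cast h4 i) x₀)
              = (fun a ↦ update s 3 (-s 3) a x₀) ∘ Fin.cast h4 := rfl
            _ = update (fun a ↦ s a x₀) 3 (-s 3 x₀) ∘ Fin.cast h4 := by rw [update_neg_apply]
            _ = update (fun a ↦ s a x₀) (Fin.cast h4 (Fin.cast h4.symm 3)) (-s 3 x₀) ∘
                  Fin.cast h4 := by rw [← h3]
            _ = update ((fun a ↦ s a x₀) ∘ Fin.cast h4) (Fin.cast h4.symm 3) (-s 3 x₀) :=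
                  update_comp_eq_of_injective _ (Fin.cast_injective h4) _ _
            _ = _ := rfl
        rw [key]
        have hneg := (o.isPosFrame_update_neg_iff x₀ hdet (Fin.cast h4.symm 3)).2 ho
        have h3' : -s 3 x₀ = -(fun i ↦ s (Fin.cast h4 i) x₀) (Fin.cast h4.symm 3) := by
          show -s 3 x₀ = -s (Fin.cast h4 (Fin.cast h4.symm 3)) x₀
          rw [← h3]
        rw [h3']
        exact hneg
  -- positivity on a neighbourhood
  have hev := eventually_isPosFrame_of_isPosFrame o (fun a ↦ heC a x₀ hx₀) hepos
  obtain ⟨t, ht, hto, hx₀t⟩ := eventually_nhds_iff.1 hev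
  refine ⟨⟨⟨S ∩ t, hSo.inter hto⟩, e, fun a x hx ↦ (heC a x hx.1).contMDiffWithinAt,
    fun x hx ↦ heON x hx.1, fun x hx ↦ ht x hx.2⟩, hx₀, hx₀t⟩

end Existence

end Literature.Geometry.Riemannian
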